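import Summits.Ventures.CertifiedManyBodySolver.Downfold.OneBandCellEnclosure
import HarnessLib

/-!
# The direct one-band in-plane band, VII: CELL-TREE filling certificates (no monotonicity premise)

Venture CertifiedManyBodySolver, cell `pub/hubbard-downfold` (stage S1, technique B), seat hubbard-downfold-mod-4 (g25);
namespace `Summit.Ventures.CertifiedManyBodySolver.Downfold.Emery`. Everything here is PROVED; no number lives here.
WHAT THIS IS NOT: a statement about any material; `U = 0` one-body kinematics; the Brillouin-zone fraction is Lebesgue
measure (`quadFrac`), no k-mesh.

Layer 3 of the g25 device. A `CellTree` is a kd-tree over the index square `[0, K)²` of the momentum grid whose leaves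
flag a block of cells as INSIDE the occupied set `{ε ≤ e}` (`y`), OUTSIDE it (`n`) or open (`o`); `CellTree.check`
validates every flagged leaf with the integer block enclosure `blockEnclZ` (harmonic, optionally sharpened by the
mean-value form of `OneBandCellEnclosure`), so NO monotonicity of the band is needed (the g23 row-threshold device needs
`IpAnti`, false for the extended-saddle class); counting is the generic `QuadrantCellCounting`. §1 `blockEnclZ`; §2
`CellTree`, `check`, counts `inner` / `kept`, finsets `insideCells / keptCells` (`card = count`), leaf soundness; §3
**`inner/K² ≤ ipFilling S e ≤ kept/K²`**, `ipFilling_mem_of_treeCheck`, and the premise-free FERMI-ENERGY BRACKET of a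
filling window from two trees `fermi_mem_Icc_of_treeBracket` (same shape as `fermi_mem_Icc_of_ipBracketCheck`).

Sources: subdivision / interval verification [Moore1966, Theorem 3.1, §4.4]; one-band form [AndersenEtAl1995, §6].
-/

noncomputable section

namespace Summit.Ventures.CertifiedManyBodySolver.Downfold.Emery

open Real Set MeasureTheory

/-! ## §1 The block enclosure used by the leaves -/

/-- Harmonic-only block enclosure at the cell scale `10²⁴·10⁶·K`. [cite: Moore1966, Theorem 3.1] -/
def harmBlockZ (K : ℕ) (cl ch : ℕ → ℤ) (S : List (ℕ × ℕ × ℚ)) (a0 a1 b0 b1 : ℕ) : ℤ × ℤ :=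
  let hb := bandEnclZ S (arcs4 K cl ch a0 a1) (arcs4 K cl ch b0 b1)
  (hb.1 * ((hH : ℤ) * K), hb.2 * ((hH : ℤ) * K))

/-- The block enclosure of a leaf: harmonic-only (`mv = false`) or the full cell enclosure (`mv = true`). [cite: Moore1966, Theorem 3.1, §4.4] -/
def blockEnclZ (K : ℕ) (cl ch : ℕ → ℤ) (S : List (ℕ × ℕ × ℚ)) (mv : Bool) (a0 a1 b0 b1 : ℕ) : ℤ × ℤ :=
  if mv then cellEnclZ K cl ch S a0 a1 b0 b1 else harmBlockZ K cl ch S a0 a1 b0 b1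

/-- **Soundness of the leaf enclosure.** [cite: Moore1966, Theorem 3.1, §4.4] -/
theorem blockEnclZ_sound {K : ℕ} (hK : 0 < K) (hev : K % 2 = 0) {cl ch : ℕ → ℤ} (hT : CosEnclZ K cl ch)
    {S : List (ℕ × ℕ × ℚ)} (hS : hZOK S = true) (mv : Bool) {a0 a1 b0 b1 : ℕ} (ha : a0 ≤ a1) (hb : b0 ≤ b1)
    {kx ky : ℝ} (hx1 : gridPt K a0 ≤ kx) (hx2 : kx ≤ gridPt K a1) (hy1 : gridPt K b0 ≤ ky) (hy2 : ky ≤ gridPt K b1) :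
    ZEncl (blockEnclZ K cl ch S mv a0 a1 b0 b1).1 (blockEnclZ K cl ch S mv a0 a1 b0 b1).2
      (cellScale K * ipBandK S kx ky) := by
  unfold blockEnclZ
  cases mv
  · simp only [Bool.false_eq_true, if_false]
    have h := bandEnclZ_sound (arcs4_sound hK hT a0 a1) (arcs4_sound hK hT b0 b1) hS hx1 hx2 hy1 hy2
    obtain ⟨h1, h2⟩ := h
    have hM : (0 : ℝ) ≤ (hH : ℝ) * K := by positivity
    unfold harmBlockZ ZEncl cellScale
    push_cast
    constructor
    · calc _ ≤ bandScale * ipBandK S kx ky * ((hH : ℝ) * K) := mul_le_mul_of_nonneg_right h1 hM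
        _ = _ := by ring
    · calc bandScale * ((hH : ℝ) * K) * ipBandK S kx ky = bandScale * ipBandK S kx ky * ((hH : ℝ) * K) := by ring
        _ ≤ _ := mul_le_mul_of_nonneg_right h2 hM
  · simp only [if_true]
    exact cellEnclZ_sound hK hev hT hS ha hb hx1 hx2 hy1 hy2

/-! ## §2 Cell trees, the checker and the counts -/

/-- A kd-tree over an index block `[a0, a1) × [b0, b1)` of the momentum grid. [folklore] -/
inductive CellTree : Type
  /-- open: nothing claimed -/
  | o : CellTree
  /-- the whole block is INSIDE the occupied set (`mv`: use the mean-value form) -/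
  | y (mv : Bool) : CellTree
  /-- the whole block is OUTSIDE the occupied set -/
  | n (mv : Bool) : CellTree
  /-- split the `kx`-index range at `m`: `l` covers `[a0, m)`, `r` covers `[m, a1)` -/
  | i (m : ℕ) (l r : CellTree) : CellTree
  /-- split the `ky`-index range at `m` -/
  | j (m : ℕ) (l r : CellTree) : CellTree

namespace CellTree

/-- **The tree checker** at energy `e`: every `y` leaf has its block enclosure `≤ e`, every `n` leaf `> e`; splits stay
inside the block. [cite: Moore1966, §4.4] -/
def check (K : ℕ) (cl ch : ℕ → ℤ) (S : List (ℕ × ℕ × ℚ)) (e : ℚ) : CellTree → ℕ → ℕ → ℕ → ℕ → Bool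
  | o, _, _, _, _ => true
  | y mv, a0, a1, b0, b1 => decide (((blockEnclZ K cl ch S mv a0 a1 b0 b1).2 : ℚ) ≤ e * cellScaleQ K)
  | n mv, a0, a1, b0, b1 => decide (e * cellScaleQ K < ((blockEnclZ K cl ch S mv a0 a1 b0 b1).1 : ℚ))
  | i m l r, a0, a1, b0, b1 =>
      decide (a0 ≤ m) && decide (m ≤ a1) && l.check K cl ch S e a0 m b0 b1 && r.check K cl ch S e m a1 b0 b1
  | j m l r, a0, a1, b0, b1 =>
      decide (b0 ≤ m) && decide (m ≤ b1) && l.check K cl ch S e a0 a1 b0 m && r.check K cl ch S e a0 a1 m b1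

/-- Number of cells certified INSIDE. [folklore] -/
def inner : CellTree → ℕ → ℕ → ℕ → ℕ → ℕ
  | o, _, _, _, _ => 0
  | y _, a0, a1, b0, b1 => (a1 - a0) * (b1 - b0)
  | n _, _, _, _, _ => 0
  | i m l r, a0, a1, b0, b1 => l.inner a0 m b0 b1 + r.inner m a1 b0 b1
  | j m l r, a0, a1, b0, b1 => l.inner a0 a1 b0 m + r.inner a0 a1 m b1

/-- Number of cells NOT certified outside. [folklore] -/
def kept : CellTree → ℕ → ℕ → ℕ → ℕ → ℕ
  | o, a0, a1, b0, b1 => (a1 - a0) * (b1 - b0)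
  | y _, a0, a1, b0, b1 => (a1 - a0) * (b1 - b0)
  | n _, _, _, _, _ => 0
  | i m l r, a0, a1, b0, b1 => l.kept a0 m b0 b1 + r.kept m a1 b0 b1
  | j m l r, a0, a1, b0, b1 => l.kept a0 a1 b0 m + r.kept a0 a1 m b1

/-- The cells certified inside, as a finset. [folklore] -/
def insideCells : CellTree → ℕ → ℕ → ℕ → ℕ → Finset (ℕ × ℕ)
  | o, _, _, _, _ => ∅
  | y _, a0, a1, b0, b1 => Finset.Ico a0 a1 ×ˢ Finset.Ico b0 b1
  | n _, _, _, _, _ => ∅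
  | i m l r, a0, a1, b0, b1 => l.insideCells a0 m b0 b1 ∪ r.insideCells m a1 b0 b1
  | j m l r, a0, a1, b0, b1 => l.insideCells a0 a1 b0 m ∪ r.insideCells a0 a1 m b1

/-- The cells not certified outside, as a finset. [folklore] -/
def keptCells : CellTree → ℕ → ℕ → ℕ → ℕ → Finset (ℕ × ℕ)
  | o, a0, a1, b0, b1 => Finset.Ico a0 a1 ×ˢ Finset.Ico b0 b1
  | y _, a0, a1, b0, b1 => Finset.Ico a0 a1 ×ˢ Finset.Ico b0 b1
  | n _, _, _, _, _ => ∅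
  | i m l r, a0, a1, b0, b1 => l.keptCells a0 m b0 b1 ∪ r.keptCells m a1 b0 b1
  | j m l r, a0, a1, b0, b1 => l.keptCells a0 a1 b0 m ∪ r.keptCells a0 a1 m b1

/-- The block's cells. [folklore] -/
def blockCells (a0 a1 b0 b1 : ℕ) : Finset (ℕ × ℕ) := Finset.Ico a0 a1 ×ˢ Finset.Ico b0 b1

/-- [folklore] -/
theorem mem_blockCells {a0 a1 b0 b1 : ℕ} {p : ℕ × ℕ} :
    p ∈ blockCells a0 a1 b0 b1 ↔ a0 ≤ p.1 ∧ p.1 < a1 ∧ b0 ≤ p.2 ∧ p.2 < b1 := by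
  unfold blockCells; simp [Finset.mem_product, Finset.mem_Ico, and_assoc]

variable {K : ℕ} {cl ch : ℕ → ℤ} {S : List (ℕ × ℕ × ℚ)} {e : ℚ}

/-- Inside cells lie in the block. [folklore] -/
theorem insideCells_subset : ∀ (t : CellTree) (a0 a1 b0 b1 : ℕ), t.check K cl ch S e a0 a1 b0 b1 = true →
    t.insideCells a0 a1 b0 b1 ⊆ blockCells a0 a1 b0 b1
  | o, _, _, _, _, _ => by simp [insideCells]
  | y _, _, _, _, _, _ => by simp [insideCells, blockCells]
  | n _, _, _, _, _, _ => by simp [insideCells]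
  | i m l r, a0, a1, b0, b1, h => by
      simp only [check, Bool.and_eq_true, decide_eq_true_eq] at h
      obtain ⟨⟨⟨h1, h2⟩, hlo⟩, hhi⟩ := h
      intro p hp
      simp only [insideCells, Finset.mem_union] at hp
      rw [mem_blockCells]
      rcases hp with hp | hp
      · have := (mem_blockCells.1 (insideCells_subset l _ _ _ _ hlo hp)); omega
      · have := (mem_blockCells.1 (insideCells_subset r _ _ _ _ hhi hp)); omega
  | j m l r, a0, a1, b0, b1, h => by
      simp only [check, Bool.and_eq_true, decide_eq_true_eq] at h
      obtain ⟨⟨⟨h1, h2⟩, hlo⟩, hhi⟩ := h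
      intro p hp
      simp only [insideCells, Finset.mem_union] at hp
      rw [mem_blockCells]
      rcases hp with hp | hp
      · have := (mem_blockCells.1 (insideCells_subset l _ _ _ _ hlo hp)); omega
      · have := (mem_blockCells.1 (insideCells_subset r _ _ _ _ hhi hp)); omega

/-- Kept cells lie in the block. [folklore] -/
theorem keptCells_subset : ∀ (t : CellTree) (a0 a1 b0 b1 : ℕ), t.check K cl ch S e a0 a1 b0 b1 = true →
    t.keptCells a0 a1 b0 b1 ⊆ blockCells a0 a1 b0 b1
  | o, _, _, _, _, _ => by simp [keptCells, blockCells]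
  | y _, _, _, _, _, _ => by simp [keptCells, blockCells]
  | n _, _, _, _, _, _ => by simp [keptCells]
  | i m l r, a0, a1, b0, b1, h => by
      simp only [check, Bool.and_eq_true, decide_eq_true_eq] at h
      obtain ⟨⟨⟨h1, h2⟩, hlo⟩, hhi⟩ := h
      intro p hp
      simp only [keptCells, Finset.mem_union] at hp
      rw [mem_blockCells]
      rcases hp with hp | hp
      · have := (mem_blockCells.1 (keptCells_subset l _ _ _ _ hlo hp)); omega
      · have := (mem_blockCells.1 (keptCells_subset r _ _ _ _ hhi hp)); omega
  | j m l r, a0, a1, b0, b1, h => by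
      simp only [check, Bool.and_eq_true, decide_eq_true_eq] at h
      obtain ⟨⟨⟨h1, h2⟩, hlo⟩, hhi⟩ := h
      intro p hp
      simp only [keptCells, Finset.mem_union] at hp
      rw [mem_blockCells]
      rcases hp with hp | hp
      · have := (mem_blockCells.1 (keptCells_subset l _ _ _ _ hlo hp)); omega
      · have := (mem_blockCells.1 (keptCells_subset r _ _ _ _ hhi hp)); omega

/-- `card insideCells = inner`. [folklore] -/
theorem card_insideCells : ∀ (t : CellTree) (a0 a1 b0 b1 : ℕ), t.check K cl ch S e a0 a1 b0 b1 = true →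
    (t.insideCells a0 a1 b0 b1).card = t.inner a0 a1 b0 b1
  | o, _, _, _, _, _ => by simp [insideCells, inner]
  | y _, a0, a1, b0, b1, _ => by simp [insideCells, inner]
  | n _, _, _, _, _, _ => by simp [insideCells, inner]
  | i m l r, a0, a1, b0, b1, h => by
      simp only [check, Bool.and_eq_true, decide_eq_true_eq] at h
      obtain ⟨⟨⟨h1, h2⟩, hlo⟩, hhi⟩ := h
      simp only [insideCells, inner]
      rw [Finset.card_union_of_disjoint, card_insideCells l _ _ _ _ hlo, card_insideCells r _ _ _ _ hhi]
      refine Finset.disjoint_left.2 fun {p} hp hp' => ?_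
      have a := mem_blockCells.1 (insideCells_subset l _ _ _ _ hlo hp)
      have b := mem_blockCells.1 (insideCells_subset r _ _ _ _ hhi hp')
      omega
  | j m l r, a0, a1, b0, b1, h => by
      simp only [check, Bool.and_eq_true, decide_eq_true_eq] at h
      obtain ⟨⟨⟨h1, h2⟩, hlo⟩, hhi⟩ := h
      simp only [insideCells, inner]
      rw [Finset.card_union_of_disjoint, card_insideCells l _ _ _ _ hlo, card_insideCells r _ _ _ _ hhi]
      refine Finset.disjoint_left.2 fun {p} hp hp' => ?_
      have a := mem_blockCells.1 (insideCells_subset l _ _ _ _ hlo hp)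
      have b := mem_blockCells.1 (insideCells_subset r _ _ _ _ hhi hp')
      omega

/-- `card keptCells = kept`. [folklore] -/
theorem card_keptCells : ∀ (t : CellTree) (a0 a1 b0 b1 : ℕ), t.check K cl ch S e a0 a1 b0 b1 = true →
    (t.keptCells a0 a1 b0 b1).card = t.kept a0 a1 b0 b1
  | o, a0, a1, b0, b1, _ => by simp [keptCells, kept]
  | y _, a0, a1, b0, b1, _ => by simp [keptCells, kept]
  | n _, _, _, _, _, _ => by simp [keptCells, kept]
  | i m l r, a0, a1, b0, b1, h => by
      simp only [check, Bool.and_eq_true, decide_eq_true_eq] at h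
      obtain ⟨⟨⟨h1, h2⟩, hlo⟩, hhi⟩ := h
      simp only [keptCells, kept]
      rw [Finset.card_union_of_disjoint, card_keptCells l _ _ _ _ hlo, card_keptCells r _ _ _ _ hhi]
      refine Finset.disjoint_left.2 fun {p} hp hp' => ?_
      have a := mem_blockCells.1 (keptCells_subset l _ _ _ _ hlo hp)
      have b := mem_blockCells.1 (keptCells_subset r _ _ _ _ hhi hp')
      omega
  | j m l r, a0, a1, b0, b1, h => by
      simp only [check, Bool.and_eq_true, decide_eq_true_eq] at h
      obtain ⟨⟨⟨h1, h2⟩, hlo⟩, hhi⟩ := h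
      simp only [keptCells, kept]
      rw [Finset.card_union_of_disjoint, card_keptCells l _ _ _ _ hlo, card_keptCells r _ _ _ _ hhi]
      refine Finset.disjoint_left.2 fun {p} hp hp' => ?_
      have a := mem_blockCells.1 (keptCells_subset l _ _ _ _ hlo hp)
      have b := mem_blockCells.1 (keptCells_subset r _ _ _ _ hhi hp')
      omega

/-- **Leaf soundness, inside**: a passing `y` leaf puts the closed block below `e`. [cite: Moore1966, Theorem 3.1, §4.4] -/
theorem le_of_leafIn (hK : 0 < K) (hev : K % 2 = 0) (hT : CosEnclZ K cl ch) (hS : hZOK S = true) {mv : Bool}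
    {a0 a1 b0 b1 : ℕ} (ha : a0 ≤ a1) (hb : b0 ≤ b1) (h : (y mv).check K cl ch S e a0 a1 b0 b1 = true)
    {kx ky : ℝ} (hx1 : gridPt K a0 ≤ kx) (hx2 : kx ≤ gridPt K a1) (hy1 : gridPt K b0 ≤ ky) (hy2 : ky ≤ gridPt K b1) :
    ipBandK S kx ky ≤ (e : ℝ) := by
  have henc := (blockEnclZ_sound hK hev hT hS mv ha hb hx1 hx2 hy1 hy2).2
  simp only [check, decide_eq_true_eq] at h
  have h' := (Rat.cast_le (K := ℝ)).2 h
  push_cast at h'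
  rw [cast_cellScaleQ] at h'
  have hsc := cellScale_pos hK
  nlinarith

/-- **Leaf soundness, outside**: a passing `n` leaf puts the closed block strictly above `e`. [cite: Moore1966, Theorem 3.1, §4.4] -/
theorem lt_of_leafOut (hK : 0 < K) (hev : K % 2 = 0) (hT : CosEnclZ K cl ch) (hS : hZOK S = true) {mv : Bool}
    {a0 a1 b0 b1 : ℕ} (ha : a0 ≤ a1) (hb : b0 ≤ b1) (h : (n mv).check K cl ch S e a0 a1 b0 b1 = true)
    {kx ky : ℝ} (hx1 : gridPt K a0 ≤ kx) (hx2 : kx ≤ gridPt K a1) (hy1 : gridPt K b0 ≤ ky) (hy2 : ky ≤ gridPt K b1) :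
    (e : ℝ) < ipBandK S kx ky := by
  have henc := (blockEnclZ_sound hK hev hT hS mv ha hb hx1 hx2 hy1 hy2).1
  simp only [check, decide_eq_true_eq] at h
  have h' := (Rat.cast_lt (K := ℝ)).2 h
  push_cast at h'
  rw [cast_cellScaleQ] at h'
  have hsc := cellScale_pos hK
  nlinarith

/-- Every certified-inside cell lies in the occupied set. [folklore] -/
theorem cellIco_subset_ipOcc_of_check (hK : 0 < K) (hev : K % 2 = 0) (hT : CosEnclZ K cl ch) (hS : hZOK S = true) :
    ∀ (t : CellTree) (a0 a1 b0 b1 : ℕ), a1 ≤ K → b1 ≤ K → t.check K cl ch S e a0 a1 b0 b1 = true →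
    ∀ ij ∈ t.insideCells a0 a1 b0 b1, cellIco K ij ⊆ ipOcc S e
  | o, _, _, _, _, _, _, _ => by simp [insideCells]
  | n _, _, _, _, _, _, _, _ => by simp [insideCells]
  | y mv, a0, a1, b0, b1, ha1, hb1, h => by
      intro ij hij k hk
      simp only [insideCells, Finset.mem_product, Finset.mem_Ico] at hij
      obtain ⟨⟨hi0, hi1⟩, ⟨hj0, hj1⟩⟩ := hij
      obtain ⟨⟨h1lo, h1hi⟩, ⟨h2lo, h2hi⟩⟩ := hk
      have hx1 : gridPt K a0 ≤ k.1 := (gridPt_mono K hi0).trans h1lo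
      have hx2 : k.1 ≤ gridPt K a1 := h1hi.le.trans (gridPt_mono K (by omega))
      have hy1 : gridPt K b0 ≤ k.2 := (gridPt_mono K hj0).trans h2lo
      have hy2 : k.2 ≤ gridPt K b1 := h2hi.le.trans (gridPt_mono K (by omega))
      refine ⟨⟨⟨(gridPt_nonneg K _).trans hx1, hx2.trans (gridPt_le_pi hK ha1)⟩,
        ⟨(gridPt_nonneg K _).trans hy1, hy2.trans (gridPt_le_pi hK hb1)⟩⟩, ?_⟩
      exact le_of_leafIn hK hev hT hS (by omega) (by omega) h hx1 hx2 hy1 hy2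
  | i m l r, a0, a1, b0, b1, ha1, hb1, h => by
      have h0 := h
      simp only [check, Bool.and_eq_true, decide_eq_true_eq] at h
      obtain ⟨⟨⟨h1, h2⟩, hl⟩, hr⟩ := h
      intro ij hij
      simp only [insideCells, Finset.mem_union] at hij
      rcases hij with hij | hij
      · exact cellIco_subset_ipOcc_of_check hK hev hT hS l a0 m b0 b1 (h2.trans ha1) hb1 hl ij hij
      · exact cellIco_subset_ipOcc_of_check hK hev hT hS r m a1 b0 b1 ha1 hb1 hr ij hij
  | j m l r, a0, a1, b0, b1, ha1, hb1, h => by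
      simp only [check, Bool.and_eq_true, decide_eq_true_eq] at h
      obtain ⟨⟨⟨h1, h2⟩, hl⟩, hr⟩ := h
      intro ij hij
      simp only [insideCells, Finset.mem_union] at hij
      rcases hij with hij | hij
      · exact cellIco_subset_ipOcc_of_check hK hev hT hS l a0 a1 b0 m ha1 (h2.trans hb1) hl ij hij
      · exact cellIco_subset_ipOcc_of_check hK hev hT hS r a0 a1 m b1 ha1 hb1 hr ij hij

/-- Every block cell that is NOT kept misses the occupied set (closed cell). [folklore] -/
theorem disjoint_ipOcc_of_check (hK : 0 < K) (hev : K % 2 = 0) (hT : CosEnclZ K cl ch) (hS : hZOK S = true) :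
    ∀ (t : CellTree) (a0 a1 b0 b1 : ℕ), a1 ≤ K → b1 ≤ K → t.check K cl ch S e a0 a1 b0 b1 = true →
    ∀ p : ℕ × ℕ, p ∈ blockCells a0 a1 b0 b1 → p ∉ t.keptCells a0 a1 b0 b1 → Disjoint (cellIcc K p) (ipOcc S e)
  | o, a0, a1, b0, b1, _, _, _ => by
      intro p hp hnot; simp only [keptCells] at hnot; exact absurd hp hnot
  | y _, a0, a1, b0, b1, _, _, _ => by
      intro p hp hnot; simp only [keptCells] at hnot; exact absurd hp hnot
  | n mv, a0, a1, b0, b1, ha1, hb1, h => by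
      intro p hp _
      rw [mem_blockCells] at hp
      obtain ⟨hi0, hi1, hj0, hj1⟩ := hp
      rw [Set.disjoint_left]
      rintro k ⟨⟨h1lo, h1hi⟩, ⟨h2lo, h2hi⟩⟩ ⟨-, hocc⟩
      have hx1 : gridPt K a0 ≤ k.1 := (gridPt_mono K hi0).trans h1lo
      have hx2 : k.1 ≤ gridPt K a1 := h1hi.trans (gridPt_mono K (by omega))
      have hy1 : gridPt K b0 ≤ k.2 := (gridPt_mono K hj0).trans h2lo
      have hy2 : k.2 ≤ gridPt K b1 := h2hi.trans (gridPt_mono K (by omega))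
      have := lt_of_leafOut hK hev hT hS (by omega) (by omega) h hx1 hx2 hy1 hy2
      linarith
  | i m l r, a0, a1, b0, b1, ha1, hb1, h => by
      simp only [check, Bool.and_eq_true, decide_eq_true_eq] at h
      obtain ⟨⟨⟨h1, h2⟩, hl⟩, hr⟩ := h
      intro p hp hnot
      simp only [keptCells, Finset.mem_union, not_or] at hnot
      rw [mem_blockCells] at hp
      by_cases hpm : p.1 < m
      · exact disjoint_ipOcc_of_check hK hev hT hS l a0 m b0 b1 (h2.trans ha1) hb1 hl p
          (mem_blockCells.2 (by omega)) hnot.1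
      · exact disjoint_ipOcc_of_check hK hev hT hS r m a1 b0 b1 ha1 hb1 hr p
          (mem_blockCells.2 (by omega)) hnot.2
  | j m l r, a0, a1, b0, b1, ha1, hb1, h => by
      simp only [check, Bool.and_eq_true, decide_eq_true_eq] at h
      obtain ⟨⟨⟨h1, h2⟩, hl⟩, hr⟩ := h
      intro p hp hnot
      simp only [keptCells, Finset.mem_union, not_or] at hnot
      rw [mem_blockCells] at hp
      by_cases hpm : p.2 < m
      · exact disjoint_ipOcc_of_check hK hev hT hS l a0 a1 b0 m ha1 (h2.trans hb1) hl p
          (mem_blockCells.2 (by omega)) hnot.1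
      · exact disjoint_ipOcc_of_check hK hev hT hS r a0 a1 m b1 ha1 hb1 hr p
          (mem_blockCells.2 (by omega)) hnot.2

end CellTree

/-! ## §3 The filling bounds from a checked tree; the Fermi-energy bracket from two trees -/

/-- TREE CHECK at energy `e` on the whole quadrant (amplitude integrality + the tree checker on `[0, K)²`). [folklore] -/
def treeCheck (K : ℕ) (cl ch : ℕ → ℤ) (S : List (ℕ × ℕ × ℚ)) (e : ℚ) (t : CellTree) : Bool :=
  hZOK S && t.check K cl ch S e 0 K 0 K

/-- **INNER BOUND**: `inner/K² ≤ ipFilling S e`. [folklore] -/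
theorem inner_le_ipFilling {K : ℕ} (hK : 0 < K) (hev : K % 2 = 0) {cl ch : ℕ → ℤ} (hT : CosEnclZ K cl ch)
    {S : List (ℕ × ℕ × ℚ)} {e : ℚ} {t : CellTree} (h : treeCheck K cl ch S e t = true) :
    ((t.inner 0 K 0 K : ℕ) : ℝ) / (K : ℝ) ^ 2 ≤ ipFilling S e := by
  simp only [treeCheck, Bool.and_eq_true] at h
  have := card_div_sq_le_quadFrac hK (ipOcc_subset S e) (t.insideCells 0 K 0 K)
    (CellTree.cellIco_subset_ipOcc_of_check hK hev hT h.1 t 0 K 0 K le_rfl le_rfl h.2)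
  rw [CellTree.card_insideCells t 0 K 0 K h.2] at this
  exact this

/-- **OUTER BOUND**: `ipFilling S e ≤ kept/K²`. [folklore] -/
theorem ipFilling_le_kept {K : ℕ} (hK : 0 < K) (hev : K % 2 = 0) {cl ch : ℕ → ℤ} (hT : CosEnclZ K cl ch)
    {S : List (ℕ × ℕ × ℚ)} {e : ℚ} {t : CellTree} (h : treeCheck K cl ch S e t = true) :
    ipFilling S e ≤ ((t.kept 0 K 0 K : ℕ) : ℝ) / (K : ℝ) ^ 2 := by
  simp only [treeCheck, Bool.and_eq_true] at h
  have := quadFrac_le_card_div_sq hK (ipOcc_subset S e) (t.keptCells 0 K 0 K) (fun i j hi hj hnot =>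
    CellTree.disjoint_ipOcc_of_check hK hev hT h.1 t 0 K 0 K le_rfl le_rfl h.2 (i, j)
      (CellTree.mem_blockCells.2 ⟨Nat.zero_le _, hi, Nat.zero_le _, hj⟩) hnot)
  rw [CellTree.card_keptCells t 0 K 0 K h.2] at this
  exact this

/-- **The filling at a rational energy is enclosed by the two counts of ONE checked tree.** [folklore] -/
theorem ipFilling_mem_of_treeCheck {K : ℕ} (hK : 0 < K) (hev : K % 2 = 0) {cl ch : ℕ → ℤ} (hT : CosEnclZ K cl ch)
    {S : List (ℕ × ℕ × ℚ)} {e : ℚ} {t : CellTree} (h : treeCheck K cl ch S e t = true) :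
    ipFilling S e ∈ Icc (((t.inner 0 K 0 K : ℕ) : ℝ) / (K : ℝ) ^ 2) (((t.kept 0 K 0 K : ℕ) : ℝ) / (K : ℝ) ^ 2) :=
  ⟨inner_le_ipFilling hK hev hT h, ipFilling_le_kept hK hev hT h⟩

/-- BRACKET SIDE CONDITIONS of a filling window `[ν₁, ν₂]`: `e₁ ≤ e₂`, `kept(t₁) < ν₁K²`, `ν₂K² < inner(t₂)`. [folklore] -/
def treeBracketSides (K : ℕ) (e₁ e₂ ν₁ ν₂ : ℚ) (kept₁ inner₂ : ℕ) : Bool :=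
  decide (e₁ ≤ e₂) && decide ((kept₁ : ℚ) < ν₁ * (K : ℚ) ^ 2) && decide (ν₂ * (K : ℚ) ^ 2 < (inner₂ : ℚ))

/-- **THE FERMI-ENERGY BRACKET (premise-free)**: trees `t₁` checked at `e₁` and `t₂` at `e₂` with
`kept(t₁) < ν₁K²` and `ν₂K² < inner(t₂)`: every `ε` whose filling lies in `[ν₁, ν₂]` lies in `[e₁, e₂]`. [folklore] -/
theorem fermi_mem_Icc_of_treeBracket {K : ℕ} (hK : 0 < K) (hev : K % 2 = 0) {cl ch : ℕ → ℤ} (hT : CosEnclZ K cl ch)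
    {S : List (ℕ × ℕ × ℚ)} {e₁ e₂ ν₁ ν₂ : ℚ} {t₁ t₂ : CellTree}
    (h₁ : treeCheck K cl ch S e₁ t₁ = true) (h₂ : treeCheck K cl ch S e₂ t₂ = true)
    (hs : treeBracketSides K e₁ e₂ ν₁ ν₂ (t₁.kept 0 K 0 K) (t₂.inner 0 K 0 K) = true)
    {ε : ℝ} (hν : ipFilling S ε ∈ Icc (ν₁ : ℝ) ν₂) : ε ∈ Icc (e₁ : ℝ) e₂ := by
  simp only [treeBracketSides, Bool.and_eq_true, decide_eq_true_eq] at hs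
  obtain ⟨⟨-, hso⟩, hsi⟩ := hs
  have hKr : (0 : ℝ) < K := by exact_mod_cast hK
  have hout := ipFilling_le_kept hK hev hT h₁
  have hin := inner_le_ipFilling hK hev hT h₂
  have hso' : ((t₁.kept 0 K 0 K : ℕ) : ℝ) / (K : ℝ) ^ 2 < (ν₁ : ℝ) := by
    rw [div_lt_iff₀ (by positivity)]
    have := (Rat.cast_lt (K := ℝ)).2 hso
    push_cast at this ⊢; exact this
  have hsi' : (ν₂ : ℝ) < ((t₂.inner 0 K 0 K : ℕ) : ℝ) / (K : ℝ) ^ 2 := by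
    rw [lt_div_iff₀ (by positivity)]
    have := (Rat.cast_lt (K := ℝ)).2 hsi
    push_cast at this ⊢; exact this
  exact mem_Icc_of_monotone_bracket (ipFilling_monotone S) hout hso' hin hsi' hν

end Summit.Ventures.CertifiedManyBodySolver.Downfold.Emery
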